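import Literature.MathematicalPhysics.QuantumFieldTheory.Balaban1983to89.B13Sect1Arith

/-!
# NE9CauchyOpLinear — the iterated Cauchy operation (1.23) `B13Sect1Arith.cauchyOp` is CONTINUOUS in (parameter, s, σ) and
LINEAR in its integrand under continuity on the contours (cell `pub-balaban`, T4-DAG §2 node U3 ∕ §6 NE9; NE9 formalisation
swarm, unit `b2b-balaban-t4-ne9-formalise-leaf-03` gen 4; own-initiative micro-item «A3-LIN», CLAIMS.log l.8538, ENGINE half —
the species half is the sibling `NE9RemainderPieceLinear`, split at the 400-line cap)

HONEST FRAMING (T4-DAG PAGE 1).  Rung (B)+1 of the FINITE-VOLUME T⁴ programme — NOT infinite volume, NOT a mass gap, NOT the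
Clay problem.  NE9 is a cell NEW ESTIMATE, NOT PRINTED, NOT discharged here («NE9 ⇐ the named binders»); spine 0∕9; 0∕18
skeleton leaves instantiated on Bałaban's objects.  HONEST DEPENDENCY (cell line, verbatim): continuum YM on T⁴ ⇐ BetaPertH ∧
nine spine estimates (0/9 proved); BetaPertH ⇐ (D1) ∧ (D4) ∧ CAP+tail; G-an2-4 gates asym, D1 and NE2/3/4.  Pure calculus on
the tree's `cauchyOp` (pv20's literal model of the ordered product `∏_{Δ} ∫₀¹ds(Δ) (2πi)⁻¹∮_{|σ(Δ)|=ρ} dσ(Δ)∕(σ(Δ) − s(Δ))²` of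
[II] = [Balaban1988RG2Cluster] (1.23) p. 7, quoted for the TYPE only — ABSOLUTE RULE); no `def`, no Prop-valued definition;
`FlowStep.BetaPertH`, (B), (B^μ) do not occur.

WHY.  The BOUND (1.24) on the iterated operation (`B13Sect1Arith.norm_cauchyOp_le`, `bound_124`) needs no regularity of the
integrand; its LINEARITY does (a Bochner integral of a non-integrable function is 0 by convention), and linearity is what
identifies the functional of a DIFFERENCE of integrands with the difference of the functionals — the instantiation-side step
left open by this lineage's `NE9RemainderPieceCoupling` §4 (p211959; cross-read CLAIMS.log l.8492 (x2)) for leaf A3's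
displayed species, and equally the additivity-in-the-old-term step of the row owner's piece form (his item (C), CLAIMS.log
l.8319 — NOT taken here; these lemmas are SUPPLIERS for it BY NAME).  The natural regularity is CONTINUITY ON THE CONTOURS.
* `continuousOn_intervalIntegral_of_continuousOn` ∕ `continuousOn_circleIntegral_of_continuousOn`: a parametric integral over a
  FIXED compact contour of a jointly continuous integrand is continuous in the parameter (Mathlib's
  `intervalIntegral.continuous_parametric_intervalIntegral_of_continuous'` on the subtype; the s-integrand frozen outside `[0,1]`
  by `Set.projIcc`); `continuousOn_cauchyKernel`: `((z − u)²)⁻¹` has no pole for `|z| = ρ > 1 ≥ u ≥ 0`.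
* **`continuousOn_cauchyOp`** (PARAMETRIC): on a parameter set `Q` closed under the listed moves (the device of
  `norm_cauchyOp_le`) an integrand `h x s σ` jointly continuous on `T ×ˢ Q` gives `(x, s, σ) ↦ cauchyOp ρ l (h x) s σ` jointly
  continuous on `T ×ˢ Q` — induction on the list; `continuousOn_cauchyOp'` the parameter-free case.
* **`cauchyOp_sub`** ∕ `cauchyOp_add`: linearity in the integrand on `Q` (`circleIntegral.integral_sub` +
  `intervalIntegral.integral_sub` at every level, integrability from the continuity); **`pieceOp_sub`**: the same for the full
  (1.23)-functional with the t_□-circle `(2πi)⁻¹∮_{|t|=r}dt∕t²`, for integrands jointly continuous on `{|t| = r} × Q`.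
DISGUISE TEST: calculus of a contour operation — no term, no history, not NE9.  Summits-side NEW work (LEAN PLACEMENT RULE);
imports the tree's `B13Sect1Arith` BY NAME; modifies nothing.  Value = an engine, NOT summit progress.

References (TYPE only): T. Bałaban, *Renormalization group approach to lattice gauge field theories. II. Cluster expansions*,
Commun. Math. Phys. **116** (1988) 1–22 [Balaban1988RG2Cluster], (1.10) p. 4, (1.23)–(1.24) p. 7.
-/

noncomputable section

namespace Summit.QuantumFields.BalabanUV.T4Continuum.NE9CauchyOpLinear

open scoped BigOperators
open Metric Set Complex
open Literature.MathematicalPhysics.QuantumFieldTheory.Balaban1983to89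
open Literature.MathematicalPhysics.QuantumFieldTheory.Balaban1983to89.B13Sect1Arith (cauchyOp)

variable {F : Type*} [NormedAddCommGroup F] [NormedSpace ℂ F]

/-! ## §1 Parametric continuity and linearity of the iterated Cauchy operation (1.23) -/

section Param

variable {X : Type*} [TopologicalSpace X]

/-- Parametric interval integral over a FIXED compact interval: an integrand jointly continuous on `S ×ˢ [a,b]` gives a
function of the parameter continuous on `S` (Mathlib's `continuous_parametric_intervalIntegral_of_continuous'` on the
subtype, after freezing the integrand outside `[a,b]` by the projection `Set.projIcc`). [folklore] -/
theorem continuousOn_intervalIntegral_of_continuousOn {S : Set X} {G : X → ℝ → F} {a b : ℝ} (hab : a ≤ b)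
    (hG : ContinuousOn (fun p : X × ℝ => G p.1 p.2) (S ×ˢ Icc a b)) :
    ContinuousOn (fun x => ∫ u in a..b, G x u) S := by
  have hcongr : ∀ x, ∫ u in a..b, G x u = ∫ u in a..b, G x (projIcc a b hab u : ℝ) := by
    intro x
    refine intervalIntegral.integral_congr fun u hu => ?_
    rw [uIcc_of_le hab] at hu
    simp only [projIcc_of_mem hab hu]
  simp_rw [hcongr]
  rw [continuousOn_iff_continuous_restrict]
  have hc : Continuous fun p : S × ℝ => G (p.1 : X) (projIcc a b hab p.2 : ℝ) := by
    have hmap : Continuous fun p : S × ℝ => ((p.1 : X), ((projIcc a b hab p.2 : ℝ))) := by fun_prop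
    refine hG.comp_continuous hmap fun p => ?_
    exact ⟨p.1.2, (projIcc a b hab p.2).2⟩
  exact intervalIntegral.continuous_parametric_intervalIntegral_of_continuous'
    (f := fun (x : S) (u : ℝ) => G (x : X) (projIcc a b hab u : ℝ)) hc a b

/-- Parametric circle integral: an integrand jointly continuous on `S ×ˢ sphere c R` (`R ≥ 0`) gives a circle integral
continuous on `S`. [folklore] -/
theorem continuousOn_circleIntegral_of_continuousOn {S : Set X} {G : X → ℂ → F} {c : ℂ} {R : ℝ}
    (hR : 0 ≤ R) (hG : ContinuousOn (fun p : X × ℂ => G p.1 p.2) (S ×ˢ sphere c R)) :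
    ContinuousOn (fun x => ∮ z in C(c, R), G x z) S := by
  rw [continuousOn_iff_continuous_restrict]
  have hder : Continuous fun θ : ℝ => deriv (circleMap c R) θ := by
    simp only [deriv_circleMap]
    exact (continuous_circleMap 0 R).mul continuous_const
  have hc : Continuous fun p : S × ℝ => deriv (circleMap c R) p.2 • G (p.1 : X) (circleMap c R p.2) := by
    refine (hder.comp continuous_snd).smul ?_
    have hmap : Continuous fun p : S × ℝ => ((p.1 : X), circleMap c R p.2) := by fun_prop
    exact hG.comp_continuous hmap fun p => ⟨p.1.2, circleMap_mem_sphere _ hR _⟩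
  exact intervalIntegral.continuous_parametric_intervalIntegral_of_continuous'
    (f := fun (x : S) (θ : ℝ) => deriv (circleMap c R) θ • G (x : X) (circleMap c R θ)) hc 0 (2 * Real.pi)

/-- The Cauchy kernel `((z − u)²)⁻¹` of (1.23) is jointly continuous in `(u, z)` for `|u| ≤ 1` and `|z| = ρ > 1` (no pole is
met: `|z − u| ≥ ρ − 1 > 0`). [folklore] -/
theorem continuousOn_cauchyKernel {ρ : ℝ} (hρ : 1 < ρ) :
    ContinuousOn (fun p : ℝ × ℂ => ((p.2 - (p.1 : ℂ)) ^ 2)⁻¹) (Icc 0 1 ×ˢ sphere (0 : ℂ) ρ) := by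
  refine ContinuousOn.inv₀ (by fun_prop) fun p hp => ?_
  obtain ⟨hu, hz⟩ := hp
  have hzn : ‖p.2‖ = ρ := by simpa using hz
  have hun : ‖(p.1 : ℂ)‖ ≤ 1 := by
    rw [Complex.norm_real, Real.norm_eq_abs, abs_le]; exact ⟨by linarith [hu.1], hu.2⟩
  refine pow_ne_zero 2 (sub_ne_zero.mpr fun h => ?_)
  rw [h] at hzn
  linarith

end Param

/-! ### The engine: the iterated operation `cauchyOp` is continuous in (parameter, s, σ) on a move-closed parameter set -/

section Engine

variable {ι : Type*} [DecidableEq ι] {X : Type*} [TopologicalSpace X]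

/-- **PARAMETRIC CONTINUITY OF THE ITERATED CAUCHY OPERATION (1.23) (kernel).**  Let `Q` be a set of parameter vectors
`(s, σ)` closed under moving any listed coordinate inside `[0,1] × {|z| = ρ}` (the device of `B13Sect1Arith.norm_cauchyOp_le`),
`ρ > 1`, and let the integrand `h x s σ` depend on an extra parameter `x ∈ T`.  If `(x, s, σ) ↦ h x s σ` is continuous on
`T ×ˢ Q`, then so is `(x, s, σ) ↦ cauchyOp ρ l (h x) s σ` — by induction on the list: each factor
`∫₀¹ds (2πi)⁻¹∮_{|σ|=ρ} dσ/(σ − s)² (·)` is a parametric integral of a jointly continuous integrand over a compact set (the kernel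
has no pole since `|σ| = ρ > 1 ≥ s`).  (The BOUND (1.24) needed no regularity; LINEARITY of the operation does.) [folklore] -/
theorem continuousOn_cauchyOp {ρ : ℝ} (hρ : 1 < ρ) (Q : (ι → ℝ) → (ι → ℂ) → Prop) {T : Set X} :
    ∀ (l : List ι), (∀ s σ, Q s σ → ∀ i ∈ l, ∀ u ∈ Icc (0:ℝ) 1, ∀ z ∈ sphere (0:ℂ) ρ,
        Q (Function.update s i u) (Function.update σ i z)) →
      ∀ h : X → (ι → ℝ) → (ι → ℂ) → F,
        ContinuousOn (fun p : X × ((ι → ℝ) × (ι → ℂ)) => h p.1 p.2.1 p.2.2) (T ×ˢ {q | Q q.1 q.2}) →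
        ContinuousOn (fun p : X × ((ι → ℝ) × (ι → ℂ)) => cauchyOp ρ l (h p.1) p.2.1 p.2.2) (T ×ˢ {q | Q q.1 q.2})
  | [], _, h, hh => by simpa [cauchyOp] using hh
  | i :: l, hQ, h, hh => by
    have IH := continuousOn_cauchyOp hρ Q l (fun s σ hs j hj => hQ s σ hs j (List.mem_cons_of_mem i hj)) h hh
    -- the innermost integrand: parameters ((x,(s,σ)),u), variable z
    have h1 : ContinuousOn (fun q : ((X × ((ι → ℝ) × (ι → ℂ))) × ℝ) × ℂ =>
        ((q.2 - (q.1.2 : ℂ)) ^ 2)⁻¹ • cauchyOp ρ l (h q.1.1.1) (Function.update q.1.1.2.1 i q.1.2)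
          (Function.update q.1.1.2.2 i q.2))
        (((T ×ˢ {q | Q q.1 q.2}) ×ˢ Icc (0:ℝ) 1) ×ˢ sphere (0:ℂ) ρ) := by
      refine ContinuousOn.smul ?_ ?_
      · exact (continuousOn_cauchyKernel hρ).comp
          (f := fun q : ((X × ((ι → ℝ) × (ι → ℂ))) × ℝ) × ℂ => (q.1.2, q.2))
          (Continuous.continuousOn (by fun_prop)) fun q hq => ⟨hq.1.2, hq.2⟩
      · refine IH.comp (f := fun q : ((X × ((ι → ℝ) × (ι → ℂ))) × ℝ) × ℂ =>
            (q.1.1.1, (Function.update q.1.1.2.1 i q.1.2, Function.update q.1.1.2.2 i q.2))) ?_ ?_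
        · exact Continuous.continuousOn (by fun_prop)
        · intro q hq
          exact ⟨hq.1.1.1, hQ _ _ hq.1.1.2 i List.mem_cons_self _ hq.1.2 _ hq.2⟩
    have h2 := (continuousOn_circleIntegral_of_continuousOn (zero_le_one.trans hρ.le)
      (G := fun (q : (X × ((ι → ℝ) × (ι → ℂ))) × ℝ) (z : ℂ) => ((z - (q.2 : ℂ)) ^ 2)⁻¹ •
        cauchyOp ρ l (h q.1.1) (Function.update q.1.2.1 i q.2) (Function.update q.1.2.2 i z)) h1).const_smul
      (2 * Real.pi * I : ℂ)⁻¹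
    have h3 := continuousOn_intervalIntegral_of_continuousOn zero_le_one
      (G := fun (p : X × ((ι → ℝ) × (ι → ℂ))) (u : ℝ) => (2 * Real.pi * I : ℂ)⁻¹ • ∮ z in C(0, ρ), ((z - (u : ℂ)) ^ 2)⁻¹ •
        cauchyOp ρ l (h p.1) (Function.update p.2.1 i u) (Function.update p.2.2 i z)) h2
    simpa [cauchyOp] using h3

/-- The non-parametric case: an integrand continuous on a move-closed `Q` gives `cauchyOp ρ l h` continuous on `Q`. [folklore] -/
theorem continuousOn_cauchyOp' {ρ : ℝ} (hρ : 1 < ρ) (Q : (ι → ℝ) → (ι → ℂ) → Prop) (l : List ι)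
    (hQ : ∀ s σ, Q s σ → ∀ i ∈ l, ∀ u ∈ Icc (0:ℝ) 1, ∀ z ∈ sphere (0:ℂ) ρ,
      Q (Function.update s i u) (Function.update σ i z))
    (h : (ι → ℝ) → (ι → ℂ) → F) (hh : ContinuousOn (fun q : (ι → ℝ) × (ι → ℂ) => h q.1 q.2) {q | Q q.1 q.2}) :
    ContinuousOn (fun q : (ι → ℝ) × (ι → ℂ) => cauchyOp ρ l h q.1 q.2) {q | Q q.1 q.2} := by
  have hT : ContinuousOn (fun p : Unit × ((ι → ℝ) × (ι → ℂ)) => h p.2.1 p.2.2) (univ ×ˢ {q | Q q.1 q.2}) :=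
    hh.comp continuousOn_snd fun p hp => hp.2
  have hc := continuousOn_cauchyOp hρ Q (T := (univ : Set Unit)) l hQ (fun _ => h) hT
  exact hc.comp (f := fun q => ((), q)) (by fun_prop) fun q hq => ⟨mem_univ _, hq⟩

/-- **LINEARITY OF THE ITERATED CAUCHY OPERATION IN THE INTEGRAND (kernel).**  For two integrands continuous on a
move-closed `Q` (`ρ > 1`), `cauchyOp ρ l (h − h′) = cauchyOp ρ l h − cauchyOp ρ l h′` on `Q` — linearity of the interval and
circle integrals at every level of the iteration, the integrability coming from §1's continuity. [folklore] -/
theorem cauchyOp_sub {ρ : ℝ} (hρ : 1 < ρ) (Q : (ι → ℝ) → (ι → ℂ) → Prop) :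
    ∀ (l : List ι), (∀ s σ, Q s σ → ∀ i ∈ l, ∀ u ∈ Icc (0:ℝ) 1, ∀ z ∈ sphere (0:ℂ) ρ,
        Q (Function.update s i u) (Function.update σ i z)) →
      ∀ h h' : (ι → ℝ) → (ι → ℂ) → F,
        ContinuousOn (fun q : (ι → ℝ) × (ι → ℂ) => h q.1 q.2) {q | Q q.1 q.2} →
        ContinuousOn (fun q : (ι → ℝ) × (ι → ℂ) => h' q.1 q.2) {q | Q q.1 q.2} →
        ∀ s σ, Q s σ → cauchyOp ρ l (fun s σ => h s σ - h' s σ) s σ = cauchyOp ρ l h s σ - cauchyOp ρ l h' s σ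
  | [], _, h, h', _, _, s, σ, _ => by simp [cauchyOp]
  | i :: l, hQ, h, h', hh, hh', s, σ, hs => by
    have hQl : ∀ s σ, Q s σ → ∀ i ∈ l, ∀ u ∈ Icc (0:ℝ) 1, ∀ z ∈ sphere (0:ℂ) ρ,
        Q (Function.update s i u) (Function.update σ i z) :=
      fun s σ hs j hj => hQ s σ hs j (List.mem_cons_of_mem i hj)
    have IH := cauchyOp_sub hρ Q l hQl h h' hh hh'
    have hC := continuousOn_cauchyOp' hρ Q l hQl h hh
    have hC' := continuousOn_cauchyOp' hρ Q l hQl h' hh'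
    -- continuity of the two inner integrands in (u, z) on [0,1] × sphere
    have hin : ∀ g : (ι → ℝ) → (ι → ℂ) → F,
        ContinuousOn (fun q : (ι → ℝ) × (ι → ℂ) => cauchyOp ρ l g q.1 q.2) {q | Q q.1 q.2} →
        ContinuousOn (fun q : ℝ × ℂ => ((q.2 - (q.1 : ℂ)) ^ 2)⁻¹ •
          cauchyOp ρ l g (Function.update s i q.1) (Function.update σ i q.2)) (Icc (0:ℝ) 1 ×ˢ sphere (0:ℂ) ρ) := by
      intro g hg
      refine (continuousOn_cauchyKernel hρ).smul ?_
      refine hg.comp (f := fun q : ℝ × ℂ => (Function.update s i q.1, Function.update σ i q.2))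
        (Continuous.continuousOn (by fun_prop)) fun q hq => ?_
      exact hQ s σ hs i List.mem_cons_self _ hq.1 _ hq.2
    have hinC := hin h hC
    have hinC' := hin h' hC'
    -- step 1: rewrite the innermost integrand by the induction hypothesis, on the contours
    have step1 : ∀ u ∈ Icc (0:ℝ) 1,
        (∮ z in C(0, ρ), ((z - (u:ℂ)) ^ 2)⁻¹ • cauchyOp ρ l (fun s σ => h s σ - h' s σ) (Function.update s i u)
            (Function.update σ i z)) =
          (∮ z in C(0, ρ), ((z - (u:ℂ)) ^ 2)⁻¹ • cauchyOp ρ l h (Function.update s i u) (Function.update σ i z)) -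
          ∮ z in C(0, ρ), ((z - (u:ℂ)) ^ 2)⁻¹ • cauchyOp ρ l h' (Function.update s i u) (Function.update σ i z) := by
      intro u hu
      rw [← circleIntegral.integral_sub]
      · refine circleIntegral.integral_congr (zero_le_one.trans hρ.le) fun z hz => ?_
        rw [IH _ _ (hQ s σ hs i List.mem_cons_self u hu z hz), smul_sub]
      · refine ContinuousOn.circleIntegrable (zero_le_one.trans hρ.le) ?_
        exact hinC.comp (f := fun z : ℂ => (u, z)) (by fun_prop) fun z hz => ⟨hu, hz⟩
      · refine ContinuousOn.circleIntegrable (zero_le_one.trans hρ.le) ?_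
        exact hinC'.comp (f := fun z : ℂ => (u, z)) (by fun_prop) fun z hz => ⟨hu, hz⟩
    -- step 2: the u-integral
    have hI : ∀ g : (ι → ℝ) → (ι → ℂ) → F,
        ContinuousOn (fun q : ℝ × ℂ => ((q.2 - (q.1 : ℂ)) ^ 2)⁻¹ •
          cauchyOp ρ l g (Function.update s i q.1) (Function.update σ i q.2)) (Icc (0:ℝ) 1 ×ˢ sphere (0:ℂ) ρ) →
        IntervalIntegrable (fun u : ℝ => (2 * Real.pi * I : ℂ)⁻¹ • ∮ z in C(0, ρ), ((z - (u:ℂ)) ^ 2)⁻¹ •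
          cauchyOp ρ l g (Function.update s i u) (Function.update σ i z)) MeasureTheory.volume 0 1 := by
      intro g hg
      refine ContinuousOn.intervalIntegrable ?_
      rw [uIcc_of_le zero_le_one]
      exact (continuousOn_circleIntegral_of_continuousOn (zero_le_one.trans hρ.le) hg).const_smul _
    simp only [cauchyOp]
    rw [← intervalIntegral.integral_sub (hI h hinC) (hI h' hinC')]
    refine intervalIntegral.integral_congr fun u hu => ?_
    rw [uIcc_of_le zero_le_one] at hu
    rw [step1 u hu, smul_sub]

/-- Additivity of the iterated Cauchy operation in the integrand on a move-closed `Q` (from `cauchyOp_sub`). [folklore] -/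
theorem cauchyOp_add {ρ : ℝ} (hρ : 1 < ρ) (Q : (ι → ℝ) → (ι → ℂ) → Prop) (l : List ι)
    (hQ : ∀ s σ, Q s σ → ∀ i ∈ l, ∀ u ∈ Icc (0:ℝ) 1, ∀ z ∈ sphere (0:ℂ) ρ,
      Q (Function.update s i u) (Function.update σ i z))
    (h h' : (ι → ℝ) → (ι → ℂ) → F) (hh : ContinuousOn (fun q : (ι → ℝ) × (ι → ℂ) => h q.1 q.2) {q | Q q.1 q.2})
    (hh' : ContinuousOn (fun q : (ι → ℝ) × (ι → ℂ) => h' q.1 q.2) {q | Q q.1 q.2}) (s : ι → ℝ) (σ : ι → ℂ)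
    (hs : Q s σ) : cauchyOp ρ l (fun s σ => h s σ + h' s σ) s σ = cauchyOp ρ l h s σ + cauchyOp ρ l h' s σ := by
  have hsum : ContinuousOn (fun q : (ι → ℝ) × (ι → ℂ) => h q.1 q.2 + h' q.1 q.2) {q | Q q.1 q.2} := hh.add hh'
  have key := cauchyOp_sub hρ Q l hQ (fun s σ => h s σ + h' s σ) h' hsum hh' s σ hs
  have hfun : (fun s σ => (h s σ + h' s σ) - h' s σ) = h := by
    funext s σ; exact add_sub_cancel_right _ _
  rw [hfun] at key
  rw [key, sub_add_cancel]

/-- **LINEARITY OF THE FULL (1.23)-FUNCTIONAL (t_□-circle ∘ iterated operation) IN THE INTEGRAND (kernel).**  For two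
integrands `Φ t s σ`, `Φ′ t s σ` jointly continuous on `{|t| = r} × Q` (`Q` move-closed, `ρ > 1`, `r > 0`), the functional
`(2πi)⁻¹∮_{|t|=r} dt/t² · cauchyOp ρ l (Φ t) s σ` of the DIFFERENCE is the difference of the functionals, at every `(s, σ) ∈ Q`.
[cite: Balaban1988RG2Cluster, (1.23) p.7] -/
theorem pieceOp_sub {ρ r : ℝ} (hρ : 1 < ρ) (hr : 0 < r) (Q : (ι → ℝ) → (ι → ℂ) → Prop) (l : List ι)
    (hQ : ∀ s σ, Q s σ → ∀ i ∈ l, ∀ u ∈ Icc (0:ℝ) 1, ∀ z ∈ sphere (0:ℂ) ρ,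
      Q (Function.update s i u) (Function.update σ i z))
    (Φ Φ' : ℂ → (ι → ℝ) → (ι → ℂ) → F)
    (hΦ : ContinuousOn (fun p : ℂ × ((ι → ℝ) × (ι → ℂ)) => Φ p.1 p.2.1 p.2.2) (sphere (0:ℂ) r ×ˢ {q | Q q.1 q.2}))
    (hΦ' : ContinuousOn (fun p : ℂ × ((ι → ℝ) × (ι → ℂ)) => Φ' p.1 p.2.1 p.2.2) (sphere (0:ℂ) r ×ˢ {q | Q q.1 q.2}))
    (s : ι → ℝ) (σ : ι → ℂ) (hs : Q s σ) :
    (2 * Real.pi * I : ℂ)⁻¹ • (∮ t in C(0, r), (t ^ 2)⁻¹ • cauchyOp ρ l (fun s' σ' => Φ t s' σ' - Φ' t s' σ') s σ) =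
      (2 * Real.pi * I : ℂ)⁻¹ • (∮ t in C(0, r), (t ^ 2)⁻¹ • cauchyOp ρ l (Φ t) s σ) -
        (2 * Real.pi * I : ℂ)⁻¹ • (∮ t in C(0, r), (t ^ 2)⁻¹ • cauchyOp ρ l (Φ' t) s σ) := by
  -- continuity of t ↦ cauchyOp ρ l (Ψ t) s σ on the t-circle, for Ψ = Φ, Φ′
  have hcont : ∀ Ψ : ℂ → (ι → ℝ) → (ι → ℂ) → F,
      ContinuousOn (fun p : ℂ × ((ι → ℝ) × (ι → ℂ)) => Ψ p.1 p.2.1 p.2.2) (sphere (0:ℂ) r ×ˢ {q | Q q.1 q.2}) →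
      ContinuousOn (fun t : ℂ => (t ^ 2)⁻¹ • cauchyOp ρ l (Ψ t) s σ) (sphere (0:ℂ) r) := by
    intro Ψ hΨ
    refine ContinuousOn.smul ?_ ?_
    · refine ContinuousOn.inv₀ (by fun_prop) fun t ht => pow_ne_zero 2 ?_
      have : ‖t‖ = r := by simpa using ht
      intro h0; rw [h0, norm_zero] at this; exact hr.ne' this.symm
    · exact (continuousOn_cauchyOp hρ Q l hQ Ψ hΨ).comp (f := fun t : ℂ => (t, (s, σ)))
        (Continuous.continuousOn (by fun_prop)) fun t ht => ⟨ht, hs⟩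
  -- pointwise continuity in (s, σ) at a fixed t on the circle
  have hslice : ∀ Ψ : ℂ → (ι → ℝ) → (ι → ℂ) → F,
      ContinuousOn (fun p : ℂ × ((ι → ℝ) × (ι → ℂ)) => Ψ p.1 p.2.1 p.2.2) (sphere (0:ℂ) r ×ˢ {q | Q q.1 q.2}) →
      ∀ t ∈ sphere (0:ℂ) r, ContinuousOn (fun q : (ι → ℝ) × (ι → ℂ) => Ψ t q.1 q.2) {q | Q q.1 q.2} := by
    intro Ψ hΨ t ht
    exact hΨ.comp (f := fun q : (ι → ℝ) × (ι → ℂ) => (t, q)) (Continuous.continuousOn (by fun_prop))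
      fun q hq => ⟨ht, hq⟩
  rw [← smul_sub, ← circleIntegral.integral_sub ((hcont Φ hΦ).circleIntegrable hr.le)
    ((hcont Φ' hΦ').circleIntegrable hr.le)]
  congr 1
  refine circleIntegral.integral_congr hr.le fun t ht => ?_
  rw [cauchyOp_sub hρ Q l hQ (Φ t) (Φ' t) (hslice Φ hΦ t ht) (hslice Φ' hΦ' t ht) s σ hs, smul_sub]

end Engine

end Summit.QuantumFields.BalabanUV.T4Continuum.NE9CauchyOpLinear

end
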